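import Summits.QuantumFields.QCD.Theses.NestedDissectionSea
import Summits.QuantumFields.QCD.Theorems.NegativeCellsDilute.Negative.CellPositivity
import Summits.QuantumFields.QCD.Theorems.SpectralDefectExtinctionTipNoBindingStubPositivity
import Summits.QuantumFields.QCD.Theorems.SpectralDefectExtinctionTipNoBindingStubDiamagnetic

/-!
# Stub `stub_kineticEdgeCell` of line `mass-wegner-cell-index`
(crux `Summit.QuantumFields.QCD.Theses.NestedDissectionSea.NegativeCellsDilute`, item stmt-QuantumFields-13900)

**Kinetic edge of a Dirichlet Wilson cell** (clause (a) of route support `KineticEdge`,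
stmt-QuantumFields-13899, one cell at a time, GIVEN the Dirichlet ground-state bound of an open box —
the registered text of the sibling stub `stub_boxGroundState`, taken as the hypothesis): if the
Dirichlet cell of corner `x` and sides `s ≤ N` of the colour-gauged `r = 1` Wilson–Dirac matrix on the
four-torus `(ℤ/N)⁴` has a zero mode at bare mass `μ'`, then `Σ_i (1 − cos(π/s_i)) ≤ −μ'`.

Proof.
* A kernel vector `v ≠ 0` of the cell (`Matrix.exists_mulVec_eq_zero_iff`), zero-extended to a
  spinor `ψ ≠ 0` on the torus, has `⟨ψ, D(μ')ψ⟩ = ⟨v, D|_cell v⟩ = 0`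
  (`NegativeCellsDiluteCellPositivity.block_form_eq_extend`).
* The bare mass is a scalar shift, `D(μ') = D(0) + μ'·1` (`wilsonDirac_eq_sub_sum_wilsonHop`), so
  `Re⟨ψ, D(0)ψ⟩ = −μ'‖ψ‖²`.
* Wilson positivity (`TipNoBinding.PositivityNoLeakSpread.stub_positivity`):
  `Re⟨ψ, D(0)ψ⟩ = ½ Σ_{y,ν,a,α} |Σ_b U(y,ν)_{ab} ψ(y+ν̂)_{bα} − ψ(y)_{aα}|²`.
* Kato's inequality (`TipNoBinding.PositivityNoLeakSpread.stub_diamagnetic`) bounds the right-hand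
  side below by `½ Σ_{y,ν} (f(y+ν̂) − f(y))² = 4 Σ_y f(y)² − Σ_{y,ν} f(y) f(y+ν̂)` for the site
  modulus `f(y) = √(Σ_{a,α} |ψ(y)_{aα}|²)` (translation invariance of `Σ_y`), which is supported in
  the open box and has `Σ_y f(y)² = ‖ψ‖² > 0`.
* The hypothesis bounds the cross term by `(Σ_i cos(π/s_i)) Σ_y f(y)²`; cancel `‖ψ‖²`.
-/

noncomputable section

namespace Summit.QuantumFields.QCD.Cruxes.NegativeCellsDilute.MassWegnerCellIndex

open scoped BigOperators ENNReal Classical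
open MeasureTheory Filter Matrix
open Literature.MathematicalPhysics.QuantumLattice Literature.MathematicalPhysics.QuantumFieldTheory
  Literature.Probability.LatticeModels
open Summit.QuantumFields.QCD.Theorems.NegativeCellsDiluteCellPositivity
  (fund_unitary block_form_eq_extend re_star_dotProduct_self_pos)
open Summit.QuantumFields.QCD.Cruxes.TipNoBinding.PositivityNoLeakSpread
  (stub_positivity stub_diamagnetic)

/-! ## Helpers -/

/-- `Re⟨v, v⟩ = Σ_i ‖v i‖²` for a complex vector `v`. -/
private theorem kineticEdge_re_star_dotProduct_self {n : Type*} [Fintype n] (v : n → ℂ) :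
    (star v ⬝ᵥ v).re = ∑ i, ‖v i‖ ^ 2 := by
  rw [dotProduct, Complex.re_sum]
  refine Finset.sum_congr rfl fun i _ => ?_
  rw [Pi.star_apply, Complex.star_def, ← Complex.normSq_eq_conj_mul_self, Complex.ofReal_re,
    Complex.normSq_eq_norm_sq]

/-- The bare mass enters the Wilson–Dirac matrix as a scalar shift:
`D_W(U, t, 1) = D_W(U, 0, 1) + t • 1` (from `D_W(U, m, 1) = (m + 4)·1 − Σ_ν W_ν`). -/
private theorem kineticEdge_wilsonDirac_mass_shift {L : ℕ}
    (U : GaugeConfig 4 L (Matrix.specialUnitaryGroup (Fin 3) ℂ)) (t : ℝ) :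
    wilsonDirac (fundamentalRep (Fin 3)) U t 1 =
      wilsonDirac (fundamentalRep (Fin 3)) U 0 1 +
        (t : ℂ) • (1 : Matrix (TorusSite 4 L × Fin 3 × Fin 4) (TorusSite 4 L × Fin 3 × Fin 4) ℂ) := by
  rw [wilsonDirac_eq_sub_sum_wilsonHop (fundamentalRep (Fin 3)) fund_unitary U t,
    wilsonDirac_eq_sub_sum_wilsonHop (fundamentalRep (Fin 3)) fund_unitary U 0,
    show ((t + 4 : ℝ) : ℂ) = ((0 + 4 : ℝ) : ℂ) + (t : ℂ) by push_cast; ring, add_smul]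
  abel

/-- The real part of the Wilson form splits off the mass:
`Re⟨ψ, D(μ')ψ⟩ = Re⟨ψ, D(0)ψ⟩ + μ' Σ_i ‖ψ i‖²`. -/
private theorem kineticEdge_form_re {L : ℕ} [NeZero L]
    (U : GaugeConfig 4 L (Matrix.specialUnitaryGroup (Fin 3) ℂ)) (μ' : ℝ)
    (ψ : TorusSite 4 L × Fin 3 × Fin 4 → ℂ) :
    (star ψ ⬝ᵥ (wilsonDirac (fundamentalRep (Fin 3)) U μ' 1 *ᵥ ψ)).re =
      (star ψ ⬝ᵥ (wilsonDirac (fundamentalRep (Fin 3)) U 0 1 *ᵥ ψ)).re + μ' * ∑ i, ‖ψ i‖ ^ 2 := by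
  rw [kineticEdge_wilsonDirac_mass_shift U μ', add_mulVec, smul_mulVec, one_mulVec,
    dotProduct_add, Complex.add_re, dotProduct_smul, smul_eq_mul, Complex.re_ofReal_mul,
    kineticEdge_re_star_dotProduct_self]

/-- The discrete kinetic identity on the torus (translation invariance of `Σ_y`):
`Σ_{y,ν} (f(y+e_ν) − f(y))² = 2 (4 Σ_y f(y)² − Σ_{y,ν} f(y) f(y+e_ν))`. -/
private theorem kineticEdge_sum_sq_sub {N : ℕ} [NeZero N] (f : TorusSite 4 N → ℝ) :
    ∑ y : TorusSite 4 N, ∑ ν : Fin 4, (f (y + Pi.single ν 1) - f y) ^ 2 =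
      2 * (4 * ∑ y, f y ^ 2 - ∑ y : TorusSite 4 N, ∑ ν : Fin 4, f y * f (y + Pi.single ν 1)) := by
  have hshift : ∀ ν : Fin 4, ∑ y : TorusSite 4 N, f (y + Pi.single ν 1) ^ 2 = ∑ y, f y ^ 2 :=
    fun ν => Equiv.sum_comp (Equiv.addRight (Pi.single ν (1 : ZMod N) : TorusSite 4 N))
      (fun y => f y ^ 2)
  have hA : ∑ y : TorusSite 4 N, ∑ ν : Fin 4, f (y + Pi.single ν 1) ^ 2 = 4 * ∑ y, f y ^ 2 := by
    rw [Finset.sum_comm]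
    simp only [hshift, Finset.sum_const, Finset.card_univ, Fintype.card_fin, nsmul_eq_mul,
      Nat.cast_ofNat]
  have hB : ∑ y : TorusSite 4 N, ∑ _ν : Fin 4, f y ^ 2 = 4 * ∑ y, f y ^ 2 := by
    simp only [Finset.sum_const, Finset.card_univ, Fintype.card_fin, nsmul_eq_mul, Nat.cast_ofNat,
      Finset.mul_sum]
  calc ∑ y : TorusSite 4 N, ∑ ν : Fin 4, (f (y + Pi.single ν 1) - f y) ^ 2
      = ∑ y : TorusSite 4 N, ∑ ν : Fin 4,
          (f (y + Pi.single ν 1) ^ 2 + f y ^ 2 - 2 * (f y * f (y + Pi.single ν 1))) := by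
        refine Finset.sum_congr rfl fun y _ => Finset.sum_congr rfl fun ν _ => ?_
        ring
    _ = ∑ y : TorusSite 4 N, ∑ ν : Fin 4, f (y + Pi.single ν 1) ^ 2 +
          ∑ y : TorusSite 4 N, ∑ _ν : Fin 4, f y ^ 2 -
          2 * ∑ y : TorusSite 4 N, ∑ ν : Fin 4, f y * f (y + Pi.single ν 1) := by
        simp only [Finset.sum_sub_distrib, Finset.sum_add_distrib, Finset.mul_sum]
    _ = 2 * (4 * ∑ y, f y ^ 2 - ∑ y : TorusSite 4 N, ∑ ν : Fin 4, f y * f (y + Pi.single ν 1)) := by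
        rw [hA, hB]
        ring

/-! ## The stub -/

/-- **Stub 1b — `kineticEdgeCell` (KINETIC EDGE of a Dirichlet Wilson cell, from the box ground-state
bound).** Clause (a) of route support `KineticEdge` (stmt-QuantumFields-13899), one cell at a time,
GIVEN the statement of `stub_boxGroundState` (taken as a hypothesis, by its registered text): if the
Dirichlet cell of corner `x` and sides `s ≤ N` has a zero mode at bare mass `μ'`, then
`Σ_i (1 − cos(π/s_i)) ≤ −μ'`. Proof: a kernel vector `v ≠ 0` of the cell
(`Matrix.exists_mulVec_eq_zero_iff`), zero-extended to `ψ` on the torus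
(`NegativeCellsDiluteCellPositivity.block_form_eq_extend`), has
`0 = Re⟨ψ, D(μ')ψ⟩ = μ'‖ψ‖² + ½ Σ_{y,ν,a,α} ‖Σ_b U(y,ν)_{ab} ψ(y+ν̂,b,α) − ψ(y,a,α)‖²`
(`D(μ') = D(0) + μ'•1` from `wilsonDirac_eq_sub_sum_wilsonHop`;
`SpectralDefectExtinctionTipNoBindingStubPositivity.stub_positivity`); Kato
(`SpectralDefectExtinctionTipNoBindingStubDiamagnetic.stub_diamagnetic`) bounds the kinetic term below
by `½ Σ_{y,ν} (f(y+ν̂) − f(y))² = 4 Σ f² − Σ_{y,ν} f(y) f(y+ν̂)` for the site modulus `f = |ψ|`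
(supported in the box, `Σ_y f(y)² = ‖ψ‖² > 0`), and the hypothesis bounds the cross term by
`(Σ cos(π/s_i)) Σ f²`. -/
theorem stub_kineticEdgeCell :
    (∀ (N : ℕ) [NeZero N] (x : TorusSite 4 N) (s : Fin 4 → ℕ) (f : TorusSite 4 N → ℝ),
      (∀ i, s i ≤ N) → (∀ y, ¬ siteBox x s y → f y = 0) →
      ∑ y, ∑ ν : Fin 4, f y * f (y + Pi.single ν 1) ≤ (∑ i, Real.cos (Real.pi / s i)) * ∑ y, f y ^ 2) →
    ∀ (N : ℕ) [NeZero N] (U : GaugeConfig 4 N (Matrix.specialUnitaryGroup (Fin 3) ℂ)) (μ' : ℝ)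
      (x : TorusSite 4 N) (s : Fin 4 → ℕ), (∀ i, s i ≤ N) → (wilsonCell U μ' x s).det = 0 →
      ∑ i, (1 - Real.cos (Real.pi / s i)) ≤ -μ' := by
  intro hbox N _ U μ' x s hsN hdet
  -- (0) a kernel vector of the cell, zero-extended to a spinor `ψ` on the torus
  obtain ⟨v, hv, hCv⟩ := Matrix.exists_mulVec_eq_zero_iff.mpr hdet
  obtain ⟨hform, -⟩ :=
    block_form_eq_extend (wilsonDirac (fundamentalRep (Fin 3)) U μ' 1) (wilsonBox x s) v
  set ψ : TorusSite 4 N × Fin 3 × Fin 4 → ℂ :=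
    fun i => if h : wilsonBox x s i then v ⟨i, h⟩ else 0 with hψdef
  have hψne : ψ ≠ 0 := by
    intro h0
    apply hv
    funext i
    have := congrFun h0 i.1
    simp only [hψdef, dif_pos i.2, Pi.zero_apply] at this
    exact this
  have hzero : star ψ ⬝ᵥ (wilsonDirac (fundamentalRep (Fin 3)) U μ' 1 *ᵥ ψ) = 0 := by
    rw [← hform]
    have hCv' : toSquareBlockProp (wilsonDirac (fundamentalRep (Fin 3)) U μ' 1) (wilsonBox x s) *ᵥ v =
        0 := hCv
    rw [hCv', dotProduct_zero]
  -- `‖ψ‖² > 0`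
  have hS : 0 < ∑ i, ‖ψ i‖ ^ 2 := by
    rw [← kineticEdge_re_star_dotProduct_self]
    exact re_star_dotProduct_self_pos hψne
  -- (1) the mass shift: `Re⟨ψ, D(0)ψ⟩ = -μ' ‖ψ‖²`
  have h1 : (star ψ ⬝ᵥ (wilsonDirac (fundamentalRep (Fin 3)) U 0 1 *ᵥ ψ)).re =
      -μ' * ∑ i, ‖ψ i‖ ^ 2 := by
    have h := kineticEdge_form_re U μ' ψ
    rw [hzero, Complex.zero_re] at h
    linarith
  -- (2) Wilson positivity: `Re⟨ψ, D(0)ψ⟩ = ½ K`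
  have h2 := stub_positivity N U ψ
  -- the site modulus `f = |ψ|`
  set f : TorusSite 4 N → ℝ := fun y => Real.sqrt (∑ a, ∑ α, ‖ψ (y, a, α)‖ ^ 2) with hfdef
  have hfsq : ∀ y, f y ^ 2 = ∑ a, ∑ α, ‖ψ (y, a, α)‖ ^ 2 := fun y =>
    Real.sq_sqrt (Finset.sum_nonneg fun _ _ => Finset.sum_nonneg fun _ _ => sq_nonneg _)
  have hsumf : ∑ y, f y ^ 2 = ∑ i, ‖ψ i‖ ^ 2 := by
    simp only [hfsq, Fintype.sum_prod_type]
  -- (3) Kato: `Σ_{y,ν} (f(y+ν̂) − f(y))² ≤ K`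
  have h3 : ∑ y : TorusSite 4 N, ∑ ν : Fin 4, (f (y + Pi.single ν 1) - f y) ^ 2 ≤
      ∑ x, ∑ μ, ∑ a, ∑ α, ‖(∑ b, (U (x, μ) : Matrix (Fin 3) (Fin 3) ℂ) a b *
        ψ (Site.shift x μ, b, α)) - ψ (x, a, α)‖ ^ 2 :=
    Finset.sum_le_sum fun y _ => Finset.sum_le_sum fun ν _ => stub_diamagnetic N U ψ y ν
  -- (4) the discrete kinetic identity
  have h4 := kineticEdge_sum_sq_sub f
  -- `f` is supported in the open box
  have hsupp : ∀ y, ¬ siteBox x s y → f y = 0 := by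
    intro y hy
    have h0 : ∀ a α, ψ (y, a, α) = 0 := by
      intro a α
      simp only [hψdef]
      exact dif_neg ((wilsonBox_iff x s (y, a, α)).not.mpr hy)
    show Real.sqrt (∑ a, ∑ α, ‖ψ (y, a, α)‖ ^ 2) = 0
    simp [h0]
  -- (5) the box ground-state bound for `f`
  have h5 := hbox N x s f hsN hsupp
  rw [hsumf] at h4 h5
  -- assemble and cancel `‖ψ‖² > 0`
  have hcos : ∑ i : Fin 4, (1 - Real.cos (Real.pi / s i)) = 4 - ∑ i, Real.cos (Real.pi / s i) := by
    rw [Finset.sum_sub_distrib, Finset.sum_const, Finset.card_univ, Fintype.card_fin]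
    norm_num
  refine le_of_mul_le_mul_right ?_ hS
  rw [hcos]
  linarith [h1, h2, h3, h4, h5]

end Summit.QuantumFields.QCD.Cruxes.NegativeCellsDilute.MassWegnerCellIndex

end
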